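import Mathlib.Analysis.Convex.Gauge
import Literature.MathematicalPhysics.QuantumFieldTheory.Balaban1983to89.B12Decay510
import Literature.MathematicalPhysics.QuantumFieldTheory.Balaban1983to89.Beta.RemainderLocality

/-!
# `Balaban1983to89.B12Decay510Gauge` — [Balaban1987RG1] (4.3)–(4.5) p. 281–282 and the (5.10) chain p. 293 IN THE GAUGE
# CURRENCY OF PRINT's (4.4) DOMAIN: the bidisc Cauchy estimate `‖∂²E[a,b]‖ ≤ 16·S·gauge_D(a)·gauge_D(b)` on a convex, balanced,
# open domain `D ∋ 0`, the kernel bound and the per-volume (5.10) bound it feeds (the cell's located repair «R-O2 (4)»)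

CITATION HEADER (lean-in-tree rule 2026-08-18).  Source: T. Bałaban, *Renormalization group approach to lattice gauge field
theories. I. Generation of effective actions in a small field approximation and a coupling constant renormalization in four
dimensions*, Commun. Math. Phys. **109** (1987) 249–301 [Balaban1987RG1] (held: `paper:balaban1987-cmp109-rg-i-small-field`;
journal page = PDF page + 248).  Cell `ym-nodeO-ideate` ∕ programme cell `ym-balaban-port`, porter seat `ymgap-nodeO-port-PTC-1`
(gen 2, helper mode; PT-H slot-8 closer-designate).  §1–§2 are ADAPTED (statements and proofs) from the NODE-O cover's line file
`nodeO-cover/LENS-1-Line-cauchy-analytic-v2.3.lean` §1 (planner seat `ymgap-nodeO-lens-1` g3, kernel-checked by CRIT-1 ∕ REF), with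
the «good domain» hypothesis spelled out as the four clauses of `B12FormatPlus.Chart44D` (`Convex ℝ D ∧ Balanced ℂ D ∧ IsOpen D ∧ 0 ∈ D`)
so that this file declares no definition.

WHAT PRINT SAYS (verbatim).  p. 281 [PDF 33], (4.4): *«Thus it is defined and analytic on the space of configurations 𝐀 satisfying
max{|𝐀|_X, |P₁(□₀)𝐀|_X, |∇^ξ𝐀|_X, |Δ^ξ𝐀|_X} < α₂. (4.4) We have also the bounds (1.18) for this function.»*; p. 282 [34], after
(4.5): *«if one of the functions 𝐁_i is localized outside the domain X, then we have the additional exponential factor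
exp(−δ₀dist^{(ξ)}(X, supp 𝐁_i))»*; p. 293 [45], (5.10): *«The representation (4.37) yields the following inequality
|Π_{μν}(x − y)| ≤ O(1)E₀ exp(−δ₁|x − y|) (5.10) with a positive constant δ₁ determined by δ₀, κ, and M (e.g., δ₁ = ½ min{δ₀, κM⁻¹})»*.

WHY THIS FILE (cell record: critic `ym-nodeO-crit-1` (R-O2), nodeO STATUS 2026-08-30T22:38Z, adopted director-ym №444; the typed mould
`B12FormatPlus.Chart44D ∕ Response9D`, v5).  At the cell's record the spaces `U^c_{k+1}` are ξ²-thin, so the chart row holds on print's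
(4.4) domain — a CONVEX, BALANCED, OPEN neighbourhood of `0` in ξ-SCALED norms — and NOT on a k-uniform polydisc; accordingly the
response rows ((R1ᴰ) of `Response9D`) are measured by the Minkowski GAUGE (Mathlib `gauge`) of that domain.  The tree's (4.5)-type
Cauchy estimate `B12Decay510.norm_mixedDeriv_le` and its (5.10) chain `abs_twoPoint_le_of_analytic ∕ decay510_of_analytic_leaves`
are stated on the polydisc `ball 0 α₂` of a normed configuration space.  This module supplies the same two arrows in the gauge
currency, so the generic Π-holomorphy port text (PT-H, `PortPiHoloUniformH`: rows `Chart44D`, `Response9D`, leaves) reaches the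
tree's carrier-free polymer sum `B12Decay510.abs_twoPoint_le_delta1` VERBATIM:
* §1 ★ `norm_mixedDeriv_le_gauge` — `E` analytic on a convex balanced open `D ∋ 0` with `‖E‖ ≤ S` there ⟹ `‖∂²E[a,b]‖ ≤ 16·S·gauge_D(a)·gauge_D(b)`
  (the ℂ-linear map `(t, s) ↦ tRa + sR′b`, `R·gauge a ≤ ½`, `R′·gauge b ≤ ½`, sends the unit polydisc of `ℂ²` into `D`; the tree's polydisc lemma
  on `ℂ²` at radius `1`, transported by `Beta.RemainderLocality.mixedDeriv_comp_clm` and bilinearity; `R ↓ 1∕(2·gauge a)`).  On a genuinely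
  seminormed direction (`gauge a = 0`, e.g. `D = univ`) the estimate reads `∂²E[a, ·] = 0` — Liouville along the complex line, as it should.
* §2 ★ `kernelBound_of_gauge` ∕ `kernelBound_norm_of_gauge` — pieces analytic on such domains `D X` with (1.18) there and responses with
  `gauge_{D X}(h_X(x)) ≤ B_h e^{−δ₀dist(x,X)}` ⟹ the tree's `KernelBound` (real-part kernel, resp. norm kernel) with `C_E = 16·E₀·B_h²`.
* §3 ★ `abs_twoPoint_le_of_gauge` ∕ `norm_twoPoint_le_of_gauge` — the per-volume (5.10) bound with the printed `δ₁ = ½ min{δ₀, κM⁻¹}`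
  (`B12Decay510.delta1`) and `C = 16E₀B_h²e^{δ₁Mc₁}K₀K₁`; `decay510_of_gauge_leaves` — the family version landing in `B12Sec2to5.Decay510`
  (= `decay510_of_analytic_leaves` with `han ∕ h118` on the domains and `hh` in the gauge).

HONEST FRAMING.  [folklore] complex analysis + the tree's own polymer-sum bookkeeping re-keyed to the gauge; nothing of Bałaban's estimates is
asserted or discharged (the analyticity, (1.18) and the response decay stay HYPOTHESES); the PT-H text is UNSIGNED at the time of writing; one
finite four-torus programme at fixed ε — NOT ℝ⁴, NOT infinite volume, NOT OS axioms, NOT a mass gap, NOT the Clay problem.  No `def`,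
`instance`, `notation`, `sorry`; axioms `{propext, Classical.choice, Quot.sound}`.
-/

noncomputable section

open Metric Filter Topology Set

namespace Literature.MathematicalPhysics.QuantumFieldTheory.Balaban1983to89.B12Decay510Gauge

open Literature.MathematicalPhysics.QuantumFieldTheory.Balaban1983to89
open Literature.MathematicalPhysics.QuantumFieldTheory.Balaban1983to89.B12Decay510
open Literature.MathematicalPhysics.QuantumFieldTheory.Balaban1983to89.Beta.RemainderLocality
  (mixedDeriv_comp_clm mixedDeriv_eq_fderiv_fderiv differentiableAt_fderiv_of_analyticAt)

/-! ## §1  The bidisc Cauchy estimate in the gauge currency of a convex balanced open domain -/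

section Cauchy

variable {W : Type*} [NormedAddCommGroup W] [NormedSpace ℂ W]

/-- On a convex open domain containing `0`, `gauge < 1` is membership. [folklore] -/
private theorem mem_of_gauge_lt_one {D : Set W} (hc : Convex ℝ D) (ho : IsOpen D) (h0 : (0 : W) ∈ D) {w : W}
    (hw : gauge D w < 1) : w ∈ D := by
  have : w ∈ {x | gauge D x < 1} := hw
  rwa [setOf_gauge_lt_one_eq_self_of_isOpen hc h0 ho] at this

/-- A function analytic on an open set containing `0` is differentiable on a small ball around `0`. [folklore] -/
private theorem exists_ball_differentiableAt {D : Set W} (ho : IsOpen D) (h0 : (0 : W) ∈ D) {E : W → ℂ} (hE : AnalyticOnNhd ℂ E D) :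
    ∃ ρ > 0, ∀ y ∈ ball (0 : W) ρ, DifferentiableAt ℂ E y := by
  obtain ⟨ρ, hρ, hball⟩ := Metric.isOpen_iff.1 ho 0 h0
  exact ⟨ρ, hρ, fun y hy => (hE y (hball hy)).differentiableAt⟩

/-- ★ **THE BIDISC CAUCHY ESTIMATE IN THE GAUGE CURRENCY** ([I] (4.3)–(4.5) read on print's (4.4) domain, the cell's R-O2 (4)): `E` analytic on a
CONVEX, BALANCED, OPEN domain `D ∋ 0` of a complex normed space with `‖E‖ ≤ S` there ⟹ `‖∂²∕∂τ₁∂τ₂ E(τ₁a + τ₂b)∣₀‖ ≤ 16·S·gauge_D(a)·gauge_D(b)`.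
The ℂ-linear map `(t, s) ↦ tRa + sR′b` with `R·gauge a ≤ ½`, `R′·gauge b ≤ ½` sends the unit polydisc of `ℂ²` into `D` (subadditivity and homogeneity of
the gauge); the polydisc lemma `B12Decay510.norm_mixedDeriv_le` on `ℂ²` at radius `1`, transported by `mixedDeriv_comp_clm` and bilinearity, gives
`‖∂²E[a,b]‖·R·R′ ≤ 4S`; then `R = 1∕(2(gauge a + ε))`, `ε → 0⁺`.  (Adapted from the NODE-O cover's line file `LENS-1-Line-cauchy-analytic-v2.3` §1.)
[cite: Balaban1987RG1, (4.3)–(4.5) pp.281–282, (4.4) p.281] -/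
theorem norm_mixedDeriv_le_gauge {D : Set W} (hc : Convex ℝ D) (hb : Balanced ℂ D) (ho : IsOpen D) (h0 : (0 : W) ∈ D)
    {E : W → ℂ} {S : ℝ} (hE : AnalyticOnNhd ℂ E D) (hS : ∀ v ∈ D, ‖E v‖ ≤ S) (a b : W) :
    ‖mixedDeriv E a b‖ ≤ 16 * S * gauge D a * gauge D b := by
  have habs : Absorbent ℝ D := absorbent_nhds_zero (ho.mem_nhds h0)
  have hS0 : 0 ≤ S := (norm_nonneg _).trans (hS 0 h0)
  have hga := gauge_nonneg (s := D) a
  have hgb := gauge_nonneg (s := D) b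
  have hd : DifferentiableAt ℂ (fderiv ℂ E) 0 := differentiableAt_fderiv_of_analyticAt (hE 0 h0)
  obtain ⟨ρ, hρ, hEρ⟩ := exists_ball_differentiableAt ho h0 hE
  have key : ∀ R R' : ℝ, 0 < R → 0 < R' → R * gauge D a ≤ 1 / 2 → R' * gauge D b ≤ 1 / 2 →
      ‖mixedDeriv E a b‖ * (R * R') ≤ 4 * S := by
    intro R R' hR hR' hRa hRb
    let T : (Fin 2 → ℂ) →L[ℂ] W :=
      (ContinuousLinearMap.proj (R := ℂ) (φ := fun _ : Fin 2 => ℂ) 0).smulRight ((R : ℂ) • a) +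
        (ContinuousLinearMap.proj (R := ℂ) (φ := fun _ : Fin 2 => ℂ) 1).smulRight ((R' : ℂ) • b)
    have hT : ∀ p : Fin 2 → ℂ, T p = p 0 • ((R : ℂ) • a) + p 1 • ((R' : ℂ) • b) := fun p => rfl
    have hmaps : ∀ p ∈ ball (0 : Fin 2 → ℂ) 1, T p ∈ D := by
      intro p hp
      rw [mem_ball_zero_iff, pi_norm_lt_iff one_pos] at hp
      apply mem_of_gauge_lt_one hc ho h0
      have hp0 := hp 0
      have hp1 := hp 1
      calc gauge D (T p) ≤ gauge D (p 0 • ((R : ℂ) • a)) + gauge D (p 1 • ((R' : ℂ) • b)) := by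
              rw [hT]; exact gauge_add_le hc habs _ _
        _ = ‖p 0‖ * (R * gauge D a) + ‖p 1‖ * (R' * gauge D b) := by
              rw [gauge_smul hb, gauge_smul hb, gauge_smul hb, gauge_smul hb, Complex.norm_real, Complex.norm_real,
                Real.norm_of_nonneg hR.le, Real.norm_of_nonneg hR'.le]
        _ ≤ ‖p 0‖ * (1 / 2) + ‖p 1‖ * (1 / 2) := by gcongr
        _ < 1 := by linarith
    have hEan : AnalyticOnNhd ℂ (fun p => E (T p)) (ball 0 1) := fun p hp => (hE (T p) (hmaps p hp)).comp (T.analyticAt p)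
    have hES : ∀ p ∈ ball (0 : Fin 2 → ℂ) 1, ‖E (T p)‖ ≤ S := fun p hp => hS _ (hmaps p hp)
    have h4 := norm_mixedDeriv_le one_pos hEan hES (Pi.single 0 1) (Pi.single 1 1)
    have he0 : ‖(Pi.single 0 1 : Fin 2 → ℂ)‖ = 1 := by rw [Pi.norm_single, norm_one]
    have he1 : ‖(Pi.single 1 1 : Fin 2 → ℂ)‖ = 1 := by rw [Pi.norm_single, norm_one]
    rw [he0, he1, one_pow, div_one, mul_one, mul_one, mixedDeriv_comp_clm hρ hEρ T] at h4
    have hT0 : T (Pi.single 0 1) = (R : ℂ) • a := by rw [hT]; simp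
    have hT1 : T (Pi.single 1 1) = (R' : ℂ) • b := by rw [hT]; simp
    have happ : ∀ (c : ℂ) (u : W), ((c • fderiv ℂ (fderiv ℂ E) 0 b) : W →L[ℂ] ℂ) u = c * (fderiv ℂ (fderiv ℂ E) 0 b) u := fun c u => rfl
    rw [hT0, hT1, mixedDeriv_eq_fderiv_fderiv hd, map_smul, map_smul, happ, smul_eq_mul, ← mixedDeriv_eq_fderiv_fderiv hd,
      norm_mul, norm_mul, Complex.norm_real, Complex.norm_real, Real.norm_of_nonneg hR.le, Real.norm_of_nonneg hR'.le] at h4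
    nlinarith [h4]
  have hεall : ∀ ε : ℝ, 0 < ε → ‖mixedDeriv E a b‖ ≤ 16 * S * (gauge D a + ε) * (gauge D b + ε) := by
    intro ε hε
    have hA : 0 < gauge D a + ε := by linarith
    have hB : 0 < gauge D b + ε := by linarith
    have h := key (1 / (2 * (gauge D a + ε))) (1 / (2 * (gauge D b + ε))) (by positivity) (by positivity)
      (by rw [div_mul_eq_mul_div, one_mul, div_le_iff₀ (by positivity)]; nlinarith)
      (by rw [div_mul_eq_mul_div, one_mul, div_le_iff₀ (by positivity)]; nlinarith)
    rw [show 1 / (2 * (gauge D a + ε)) * (1 / (2 * (gauge D b + ε))) = 1 / (4 * ((gauge D a + ε) * (gauge D b + ε))) by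
      field_simp; ring, mul_one_div, div_le_iff₀ (by positivity)] at h
    nlinarith [h]
  have hcont : ContinuousAt (fun ε : ℝ => 16 * S * (gauge D a + ε) * (gauge D b + ε)) 0 := by fun_prop
  have ht : Tendsto (fun ε : ℝ => 16 * S * (gauge D a + ε) * (gauge D b + ε)) (𝓝[>] 0)
      (𝓝 (16 * S * gauge D a * gauge D b)) := by
    have := hcont.tendsto.mono_left (nhdsWithin_le_nhds (s := Set.Ioi (0 : ℝ)))
    simpa using this
  refine ge_of_tendsto ht ?_
  filter_upwards [self_mem_nhdsWithin] with ε hε using hεall ε hε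

end Cauchy

/-! ## §2  The kernel bound of (4.35)∕(4.5) from the gauge rows -/

section Kernel

variable {S₀ : LocDomainSys} {C₀ : B12.CubeCover S₀} {Λ₀ : Type*} {W : Type*} [NormedAddCommGroup W] [NormedSpace ℂ W]

/-- ★ **KERNEL BOUND FROM THE GAUGE ROWS** (real-part kernel): pieces `E_X` analytic on convex balanced open domains `D X ∋ 0` with (1.18)
`‖E_X‖ ≤ E₀e^{−κd(X)}` there, responses with `gauge_{D X}(h_X(x)) ≤ B_h e^{−δ₀dist(x,X)}` ([15] Prop. 9 ∕ p. 282's «additional exponential factor»,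
the (R1ᴰ) row of `B12FormatPlus.Response9D`) ⟹ the tree's `KernelBound` for `Re ∂²E_X[h_X(x), h_X(y)]` with `C_E = 16·E₀·B_h²` (then
`B12Decay510.abs_twoPoint_le_delta1` applies verbatim). [cite: Balaban1987RG1, (4.3)–(4.5) pp.281–282, (4.35) p.290, (1.18) p.263] -/
theorem kernelBound_of_gauge (G : SiteGeometry C₀ Λ₀) (EX : S₀.Dom → W → ℂ) (D : S₀.Dom → Set W)
    (h : S₀.Dom → Λ₀ → W) (E2 : S₀.Dom → Λ₀ → Λ₀ → ℝ) {E₀ Bh κ δ₀ : ℝ} (hBh : 0 ≤ Bh)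
    (hD : ∀ X, Convex ℝ (D X) ∧ Balanced ℂ (D X) ∧ IsOpen (D X) ∧ (0 : W) ∈ D X)
    (han : ∀ X, AnalyticOnNhd ℂ (EX X) (D X))
    (h118 : ∀ X, ∀ w ∈ D X, ‖EX X w‖ ≤ E₀ * Real.exp (-κ * S₀.dj X))
    (hrepr : ∀ X x y, E2 X x y = (mixedDeriv (EX X) (h X x) (h X y)).re)
    (hh : ∀ X x, gauge (D X) (h X x) ≤ Bh * Real.exp (-δ₀ * G.distD x X)) :
    KernelBound G E2 (16 * E₀ * Bh ^ 2) κ δ₀ := by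
  intro X x y
  rw [hrepr]
  have hE₀ : 0 ≤ E₀ * Real.exp (-κ * S₀.dj X) := (norm_nonneg _).trans (h118 X 0 (hD X).2.2.2)
  have h1 := norm_mixedDeriv_le_gauge (hD X).1 (hD X).2.1 (hD X).2.2.1 (hD X).2.2.2 (han X) (h118 X) (h X x) (h X y)
  have hgx := gauge_nonneg (s := D X) (h X x)
  have hgy := gauge_nonneg (s := D X) (h X y)
  calc |(mixedDeriv (EX X) (h X x) (h X y)).re| ≤ ‖mixedDeriv (EX X) (h X x) (h X y)‖ := Complex.abs_re_le_norm _
    _ ≤ 16 * (E₀ * Real.exp (-κ * S₀.dj X)) * gauge (D X) (h X x) * gauge (D X) (h X y) := h1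
    _ ≤ 16 * (E₀ * Real.exp (-κ * S₀.dj X)) * (Bh * Real.exp (-δ₀ * G.distD x X)) * (Bh * Real.exp (-δ₀ * G.distD y X)) := by
          have h16 : 0 ≤ 16 * (E₀ * Real.exp (-κ * S₀.dj X)) := mul_nonneg (by norm_num) hE₀
          have hBx : 0 ≤ Bh * Real.exp (-δ₀ * G.distD x X) := mul_nonneg hBh (Real.exp_pos _).le
          exact mul_le_mul (mul_le_mul_of_nonneg_left (hh X x) h16) (hh X y) hgy (mul_nonneg h16 hBx)
    _ = 16 * E₀ * Bh ^ 2 * Real.exp (-κ * S₀.dj X) * Real.exp (-δ₀ * G.distD x X) * Real.exp (-δ₀ * G.distD y X) := by ring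

/-- ★ **KERNEL BOUND FROM THE GAUGE ROWS, norm kernel** (what the complex (4.37) sum at complex couplings needs): same hypotheses ⟹ the tree's
`KernelBound` for `‖∂²E_X[h_X(x), h_X(y)]‖` with `C_E = 16·E₀·B_h²`. [cite: Balaban1987RG1, (4.3)–(4.5) pp.281–282, (4.35) p.290, (1.18) p.263] -/
theorem kernelBound_norm_of_gauge (G : SiteGeometry C₀ Λ₀) (EX : S₀.Dom → W → ℂ) (D : S₀.Dom → Set W)
    (h : S₀.Dom → Λ₀ → W) {E₀ Bh κ δ₀ : ℝ} (hBh : 0 ≤ Bh)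
    (hD : ∀ X, Convex ℝ (D X) ∧ Balanced ℂ (D X) ∧ IsOpen (D X) ∧ (0 : W) ∈ D X)
    (han : ∀ X, AnalyticOnNhd ℂ (EX X) (D X))
    (h118 : ∀ X, ∀ w ∈ D X, ‖EX X w‖ ≤ E₀ * Real.exp (-κ * S₀.dj X))
    (hh : ∀ X x, gauge (D X) (h X x) ≤ Bh * Real.exp (-δ₀ * G.distD x X)) :
    KernelBound G (fun X x y => ‖mixedDeriv (EX X) (h X x) (h X y)‖) (16 * E₀ * Bh ^ 2) κ δ₀ := by
  intro X x y
  rw [abs_norm]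
  have h1 := norm_mixedDeriv_le_gauge (hD X).1 (hD X).2.1 (hD X).2.2.1 (hD X).2.2.2 (han X) (h118 X) (h X x) (h X y)
  have hE₀ : 0 ≤ E₀ * Real.exp (-κ * S₀.dj X) := (norm_nonneg _).trans (h118 X 0 (hD X).2.2.2)
  have hgx := gauge_nonneg (s := D X) (h X x)
  have hgy := gauge_nonneg (s := D X) (h X y)
  calc ‖mixedDeriv (EX X) (h X x) (h X y)‖
      ≤ 16 * (E₀ * Real.exp (-κ * S₀.dj X)) * gauge (D X) (h X x) * gauge (D X) (h X y) := h1
    _ ≤ 16 * (E₀ * Real.exp (-κ * S₀.dj X)) * (Bh * Real.exp (-δ₀ * G.distD x X)) * (Bh * Real.exp (-δ₀ * G.distD y X)) := by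
          have h16 : 0 ≤ 16 * (E₀ * Real.exp (-κ * S₀.dj X)) := mul_nonneg (by norm_num) hE₀
          have hBx : 0 ≤ Bh * Real.exp (-δ₀ * G.distD x X) := mul_nonneg hBh (Real.exp_pos _).le
          exact mul_le_mul (mul_le_mul_of_nonneg_left (hh X x) h16) (hh X y) hgy (mul_nonneg h16 hBx)
    _ = 16 * E₀ * Bh ^ 2 * Real.exp (-κ * S₀.dj X) * Real.exp (-δ₀ * G.distD x X) * Real.exp (-δ₀ * G.distD y X) := by ring

/-! ## §3  The per-volume (5.10) bound and the family version, in gauge currency -/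

/-- ★ **(5.10) ON ONE FINITE SYSTEM, GAUGE CURRENCY** (real-part kernel): `|Σ_X Re ∂²E_X[h_X(x), h_X(y)]| ≤ 16E₀B_h² e^{δ₁Mc₁} K₀K₁ e^{−δ₁ρ(x,y)}`,
`δ₁ = ½ min{δ₀, κM⁻¹}` — the tree's `abs_twoPoint_le_delta1` fed by `kernelBound_of_gauge`. [cite: Balaban1987RG1, (5.10) p.293] -/
theorem abs_twoPoint_le_of_gauge (G : SiteGeometry C₀ Λ₀) {ρ : Λ₀ → Λ₀ → ℝ} (EX : S₀.Dom → W → ℂ) (D : S₀.Dom → Set W)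
    (h : S₀.Dom → Λ₀ → W) (E2 : S₀.Dom → Λ₀ → Λ₀ → ℝ) {E₀ Bh κ δ₀ M c₁ K₀ K₁ : ℝ} (hE₀ : 0 ≤ E₀) (hBh : 0 ≤ Bh)
    (hK₀ : 0 ≤ K₀) (hδ₀ : 0 ≤ δ₀) (hκ : 0 ≤ κ) (hM : 0 < M)
    (hD : ∀ X, Convex ℝ (D X) ∧ Balanced ℂ (D X) ∧ IsOpen (D X) ∧ (0 : W) ∈ D X)
    (han : ∀ X, AnalyticOnNhd ℂ (EX X) (D X))
    (h118 : ∀ X, ∀ w ∈ D X, ‖EX X w‖ ≤ E₀ * Real.exp (-κ * S₀.dj X))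
    (hrepr : ∀ X x y, E2 X x y = (mixedDeriv (EX X) (h X x) (h X y)).re)
    (hh : ∀ X x, gauge (D X) (h X x) ≤ Bh * Real.exp (-δ₀ * G.distD x X))
    (hgeo : GeomLeaf G ρ M c₁) (hcube : CubeSumLeaf G (δ₀ / 2) K₁) (htree : TreeLeaf C₀ (κ / 2) K₀) (x y : Λ₀) :
    |∑ X, E2 X x y| ≤ 16 * E₀ * Bh ^ 2 * Real.exp (delta1 δ₀ κ M * M * c₁) * K₀ * K₁ *
      Real.exp (-(delta1 δ₀ κ M) * ρ x y) :=
  abs_twoPoint_le_delta1 G (by positivity) hK₀ hδ₀ hκ hM (kernelBound_of_gauge G EX D h E2 hBh hD han h118 hrepr hh)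
    hgeo hcube htree x y

/-- ★ **(5.10) ON ONE FINITE SYSTEM, GAUGE CURRENCY** (complex sum, norm): `‖Σ_X ∂²E_X[h_X(x), h_X(y)]‖ ≤ 16E₀B_h² e^{δ₁Mc₁} K₀K₁ e^{−δ₁ρ(x,y)}`
— the bound the Vitali step of the Π-holomorphy road consumes at complex couplings. [cite: Balaban1987RG1, (5.10) p.293] -/
theorem norm_twoPoint_le_of_gauge (G : SiteGeometry C₀ Λ₀) {ρ : Λ₀ → Λ₀ → ℝ} (EX : S₀.Dom → W → ℂ) (D : S₀.Dom → Set W)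
    (h : S₀.Dom → Λ₀ → W) {E₀ Bh κ δ₀ M c₁ K₀ K₁ : ℝ} (hE₀ : 0 ≤ E₀) (hBh : 0 ≤ Bh) (hK₀ : 0 ≤ K₀) (hδ₀ : 0 ≤ δ₀)
    (hκ : 0 ≤ κ) (hM : 0 < M)
    (hD : ∀ X, Convex ℝ (D X) ∧ Balanced ℂ (D X) ∧ IsOpen (D X) ∧ (0 : W) ∈ D X)
    (han : ∀ X, AnalyticOnNhd ℂ (EX X) (D X))
    (h118 : ∀ X, ∀ w ∈ D X, ‖EX X w‖ ≤ E₀ * Real.exp (-κ * S₀.dj X))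
    (hh : ∀ X x, gauge (D X) (h X x) ≤ Bh * Real.exp (-δ₀ * G.distD x X))
    (hgeo : GeomLeaf G ρ M c₁) (hcube : CubeSumLeaf G (δ₀ / 2) K₁) (htree : TreeLeaf C₀ (κ / 2) K₀) (x y : Λ₀) :
    ‖∑ X, mixedDeriv (EX X) (h X x) (h X y)‖ ≤ 16 * E₀ * Bh ^ 2 * Real.exp (delta1 δ₀ κ M * M * c₁) * K₀ * K₁ *
      Real.exp (-(delta1 δ₀ κ M) * ρ x y) := by
  have hb := abs_twoPoint_le_delta1 G (E2 := fun X x y => ‖mixedDeriv (EX X) (h X x) (h X y)‖) (by positivity) hK₀ hδ₀ hκ hM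
    (kernelBound_norm_of_gauge G EX D h hBh hD han h118 hh) hgeo hcube htree x y
  calc ‖∑ X, mixedDeriv (EX X) (h X x) (h X y)‖ ≤ ∑ X, ‖mixedDeriv (EX X) (h X x) (h X y)‖ := norm_sum_le _ _
    _ ≤ |∑ X, ‖mixedDeriv (EX X) (h X x) (h X y)‖| := le_abs_self _
    _ ≤ _ := hb

end Kernel

/-- **THE WHOLE (5.10) CHAIN IN GAUGE CURRENCY** (= `B12Decay510.decay510_of_analytic_leaves` with the Cauchy leaf on convex balanced open domains
and the response decay in their gauges): a family of finite systems, on each the pieces analytic on the domains with (1.18) there, the representation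
(4.35)∕(4.3) of the kernel as the real part of the mixed derivative on the pair of cut responses, their gauge decay, the geometry ∕ cube-sum ∕ domain-sum
leaves with volume-uniform constants, window embeddings of `ℤᵈ` eventually isometric and the limit (5.1) ⟹ `B12Sec2to5.Decay510 P (16E₀B_h² e^{δ₁Mc₁} K₀K₁) δ₁`,
`δ₁ = ½ min{δ₀, κM⁻¹}`. [cite: Balaban1987RG1, (5.10) p.293, (5.1) p.292] -/
theorem decay510_of_gauge_leaves {d : ℕ} (Sn : ℕ → LocDomainSys) (Cn : (n : ℕ) → B12.CubeCover (Sn n))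
    (Λn : ℕ → Type*) (Gn : (n : ℕ) → SiteGeometry (Cn n) (Λn n)) (ρn : (n : ℕ) → Λn n → Λn n → ℝ)
    (Wn : ℕ → Type*) [∀ n, NormedAddCommGroup (Wn n)] [∀ n, NormedSpace ℂ (Wn n)]
    (EXn : (n : ℕ) → (Sn n).Dom → Wn n → ℂ) (Dn : (n : ℕ) → (Sn n).Dom → Set (Wn n)) (hn : (n : ℕ) → (Sn n).Dom → Λn n → Wn n)
    (E2n : (n : ℕ) → (Sn n).Dom → Λn n → Λn n → ℝ) (e : (n : ℕ) → (Fin d → ℤ) → Λn n) (P : (Fin d → ℤ) → ℝ)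
    {E₀ Bh κ δ₀ M c₁ K₀ K₁ : ℝ} (hE₀ : 0 ≤ E₀) (hBh : 0 ≤ Bh) (hK₀ : 0 ≤ K₀) (hδ₀ : 0 ≤ δ₀) (hκ : 0 ≤ κ) (hM : 0 < M)
    (hD : ∀ n X, Convex ℝ (Dn n X) ∧ Balanced ℂ (Dn n X) ∧ IsOpen (Dn n X) ∧ (0 : Wn n) ∈ Dn n X)
    (han : ∀ n X, AnalyticOnNhd ℂ (EXn n X) (Dn n X))
    (h118 : ∀ n X, ∀ w ∈ Dn n X, ‖EXn n X w‖ ≤ E₀ * Real.exp (-κ * (Sn n).dj X))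
    (hrepr : ∀ n X x y, E2n n X x y = (mixedDeriv (EXn n X) (hn n X x) (hn n X y)).re)
    (hh : ∀ n X x, gauge (Dn n X) (hn n X x) ≤ Bh * Real.exp (-δ₀ * (Gn n).distD x X))
    (hgeo : ∀ n, GeomLeaf (Gn n) (ρn n) M c₁) (hcube : ∀ n, CubeSumLeaf (Gn n) (δ₀ / 2) K₁)
    (htree : ∀ n, TreeLeaf (Cn n) (κ / 2) K₀)
    (hρ : ∀ z, ∀ᶠ n in atTop, ρn n (e n 0) (e n z) = B12Sec2to5.l1 z)
    (hlim : ∀ z, Tendsto (fun n => ∑ X, E2n n X (e n 0) (e n z)) atTop (𝓝 (P z))) :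
    B12Sec2to5.Decay510 P (16 * E₀ * Bh ^ 2 * Real.exp (delta1 δ₀ κ M * M * c₁) * K₀ * K₁) (delta1 δ₀ κ M) :=
  decay510_of_family Λn ρn (fun n x y => ∑ X, E2n n X x y) e P
    (fun n x y => abs_twoPoint_le_of_gauge (Gn n) (EXn n) (Dn n) (hn n) (E2n n) hE₀ hBh hK₀ hδ₀ hκ hM (hD n) (han n)
      (h118 n) (hrepr n) (hh n) (hgeo n) (hcube n) (htree n) x y) hρ hlim

end Literature.MathematicalPhysics.QuantumFieldTheory.Balaban1983to89.B12Decay510Gauge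

end
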